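import Summits.QuantumFields.BalabanUV.Beta.GAN24.WilsonVertexSumZero

/-!
# `BalabanUV.Beta.GAN24.WilsonGradedBlockSums` — binder row G-an2-4 ∕ (CONV-C), W-slot CT-W, route «WC-TL», table fact «3F-REC» ∕ «S3C-REC» (PRICING Q-S3C):
# **THE TWO KEY OFFSET-GRADED COLOUR-BLOCK SUMS OF an3's CUBIC WILSON STENCIL VANISH** — for `γ ≠ β` and EVERY weight `φ : ℤ → ℝ` of the offset's
# `γ`-coordinate: (KL) `Σ_i φ ((wα i) γ) · wc γ i γ β = 0` and (KR) `Σ_i φ ((wβ i) γ) · wc γ i β γ = 0` (every `d`)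

NOT IN PRINT; OUR BOOKKEEPING ([folklore] finite stencil algebra over an3's DEFINED tables `PlaquetteStencilData.wα ∕ wβ ∕ wm` (the Wilson action's exact
`B`-linear one-bond Hessian vertex as ONE finite stencil) read through leaf-15's colourless register `WilsonVertexSumZero` (`wc`, `uv`) BY NAME; G-an2-4
formalisation swarm, leaf prover `b2b-balaban-gan24-formalise-leaf-04`, gen 63; part 1 of 3 — part 2 `GAN24/WilsonFaceGradedIdentity` derives (W-face) from it, part 3 `GAN24/ThreeFaceRecClosed` discharges the chain's hypothesis).
HONEST FRAMING (cell contract, verbatim): «discharging `BetaPertH` makes Bałaban's UV stability UNCONDITIONAL — a real constructive-QFT result; it is NOT the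
continuum limit and NOT the Clay problem.»  HONEST DEPENDENCY (verbatim): «continuum YM on T⁴ ⇐ BetaPertH ∧ nine spine estimates (0/9 proved); BetaPertH ⇐ (D1) ∧
(D4) ∧ CAP+tail; G-an2-4 gates asym, D1 and NE2/3/4.»

MECHANISM (generic `d`; no `decide`, no numeral case bash).  §1: the six stencil families of `WilsonIdx` (current, spin, longitudinal; difference ∕ transport ∕
far-corner readings of the remainder vertex) at the colourless instance `C := Unit`, `A := 1`, `e := unitVec` — offsets and block entries (`wα_cur … wc_fa`;
`dirBlock_one_apply`, `copies_one_apply`, `spinMat_one_apply`).  §2: (KL) and (KR) family by family and transverse direction `μ` by direction: the `(γ,β)`-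
resp. `(β,γ)`-entry of every block (`± copies`, `sTot • spinMat μ γ`, `2 • dirBlock γ μ`, `dirBlock a b` with `{a,b} ⊆ {μ,γ}`) is `0` unless `μ = β`, and at
`μ = β` the located blocks cancel in pairs INSIDE each offset grade (the current's `(γ,β)`-entry is `[γ = β] = 0`; the two plaquette copies of the spin vertex sit
at `γ`-grade `0`; the longitudinal pair has row offset `0`; the `4 × 12 ∕ 4 × 8 ∕ 4 × 2` readings of the remainder families are expanded by `Fin.sum_univ_succ` ∕
`Matrix.cons_val_succ` and cancel by `simp`).  In exact arithmetic every (family, μ) group vanishes at `d+1 = 2,…,6` (this lineage's `g63/num/key2.py`, DIAG only).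

WHAT ([folklore]; 0 `def`, 0 cited facts, 0 `def … : Prop`, 0 sorry; generic `d`; imports leaf-15's `WilsonVertexSumZero` ONLY): §1 `one_unit_apply`,
`dirBlock_one_apply`, `copies_one_apply`, `spinMat_one_apply`, `wα_∕wβ_∕wc_{cur,spin,div,di,tr,fa}`; §2 `keyL_{cur,spin,div,di,tr,fa}`, **`keyL`**,
`keyR_{cur,spin,div,di,tr,fa}`, **`keyR`**.  Asserts NO value of Bałaban's tables beyond these finite identities of an3's defined stencil; discharges NOTHING of
(C)sym ∕ (Q-D) ∕ (Q-D-rate) ∕ «T2Shape» ∕ «T2Drift» ∕ (hW, hWall) ∕ D1; NOT «D1 closed»; NEVER «G-an2-4 closed» as (CONV-C); NOT D1, NOT `BetaPertH`, NOT continuum,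
NOT Clay.  2026-08-22; no existing file touched.
-/

noncomputable section

open Finset
open scoped BigOperators
open Literature.MathematicalPhysics.QuantumFieldTheory.Balaban1983to89
open Literature.MathematicalPhysics.QuantumFieldTheory.Balaban1983to89.Beta
open B6BondElimination (unitVec unitVec_apply)
open PlaquetteStencilData (WilsonIdx RemIdx wα wβ wm fam trm dim bsm rmm dvm dvβ rmα rmβ bsα bsβ boff bd₁ bd₂ bsgn diα diβ trα trβ faα faβ)
open PlaquetteStencil (dirBlock dirBlock_apply)
open GhostTable (curM copies curα curβ)
open SpinTable (spM spα spinMat spinMat_apply spinDir spinDir_apply)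
open PlaquetteWeitzenbock (sTot)
open Summit.QuantumFields.BalabanUV.Beta.GAN24.WilsonVertexSumZero (uv wc)

namespace Summit.QuantumFields.BalabanUV.Beta.GAN24.WilsonGradedBlockSums

variable {d : ℕ}

/-! ## §1 The stencil data at the colourless instance: offsets and block entries per family -/

section Data

variable (γ : Fin (d + 1))

/-- [folklore] the unit colour matrix entry. -/
theorem one_unit_apply : (1 : Matrix Unit Unit ℝ) () () = 1 := Matrix.one_apply_eq _

/-- [folklore] direction-block entries at the colourless instance. -/
theorem dirBlock_one_apply (a b k k' : Fin (d + 1)) :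
    dirBlock a b (1 : Matrix Unit Unit ℝ) ((), k) ((), k') = if k = a ∧ k' = b then 1 else 0 := by
  rw [dirBlock_apply, one_unit_apply]

/-- [folklore] `copies` entries at the colourless instance. -/
theorem copies_one_apply (k k' : Fin (d + 1)) :
    copies (Fin (d + 1)) (1 : Matrix Unit Unit ℝ) ((), k) ((), k') = if k = k' then 1 else 0 := by
  show Matrix.blockDiagonal (fun _ : Fin (d + 1) => (1 : Matrix Unit Unit ℝ)) ((), k) ((), k') = _
  rw [Matrix.blockDiagonal_apply', one_unit_apply]

/-- [folklore] spin-matrix entries at the colourless instance. -/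
theorem spinMat_one_apply (μ k k' : Fin (d + 1)) :
    spinMat μ γ (1 : Matrix Unit Unit ℝ) ((), k) ((), k') = (if μ = k ∧ γ = k' then 1 else 0) - (if γ = k ∧ μ = k' then 1 else 0) := by
  rw [spinMat_apply, one_unit_apply, one_mul, spinDir_apply]

/-- [folklore] CURRENT family: row offset, column offset, block entry. -/
theorem wα_cur (b : Bool) : wα uv γ (Sum.inl (Sum.inl (Sum.inl b)) : WilsonIdx (Fin (d + 1))) = if b then uv γ else 0 := rfl

/-- [folklore] -/
theorem wβ_cur (b : Bool) : wβ uv γ (Sum.inl (Sum.inl (Sum.inl b)) : WilsonIdx (Fin (d + 1))) = if b then 0 else uv γ := rfl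

/-- [folklore] -/
theorem wc_cur (b : Bool) (k k' : Fin (d + 1)) :
    wc γ (Sum.inl (Sum.inl (Sum.inl b))) k k' = (if b then (1 : ℝ) else -1) * (if k = k' then 1 else 0) := by
  unfold wc
  cases b
  · simp only [wm, Sum.elim_inl, curM, Bool.false_eq_true, if_false, Matrix.neg_apply, copies_one_apply]
    ring
  · simp only [wm, Sum.elim_inl, curM, if_true, copies_one_apply]
    ring

/-- [folklore] SPIN family. -/
theorem wα_spin (p : Fin (d + 1) × Bool) :
    wα uv γ (Sum.inl (Sum.inl (Sum.inr p)) : WilsonIdx (Fin (d + 1))) = if p.2 then -uv p.1 else 0 := rfl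

/-- [folklore] -/
theorem wβ_spin (p : Fin (d + 1) × Bool) :
    wβ uv γ (Sum.inl (Sum.inl (Sum.inr p)) : WilsonIdx (Fin (d + 1))) = if p.2 then -uv p.1 else 0 := rfl

/-- [folklore] -/
theorem wc_spin (μ : Fin (d + 1)) (b : Bool) (k k' : Fin (d + 1)) :
    wc γ (Sum.inl (Sum.inl (Sum.inr (μ, b)))) k k' =
      sTot * (if b then (1 : ℝ) else -1) * ((if μ = k ∧ γ = k' then 1 else 0) - (if γ = k ∧ μ = k' then 1 else 0)) := by
  unfold wc
  cases b
  · simp only [wm, Sum.elim_inl, Sum.elim_inr, Pi.smul_apply, Matrix.smul_apply, spM, Bool.false_eq_true, if_false,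
      spinMat_one_apply, smul_eq_mul]
    ring
  · simp only [wm, Sum.elim_inl, Sum.elim_inr, Pi.smul_apply, Matrix.smul_apply, spM, if_true, spinMat_one_apply, smul_eq_mul]
    ring

/-- [folklore] LONGITUDINAL family. -/
theorem wα_div (p : Fin (d + 1) × Bool) : wα uv γ (Sum.inl (Sum.inr p) : WilsonIdx (Fin (d + 1))) = 0 := rfl

/-- [folklore] -/
theorem wβ_div (p : Fin (d + 1) × Bool) :
    wβ uv γ (Sum.inl (Sum.inr p) : WilsonIdx (Fin (d + 1))) = if p.2 then uv γ else uv γ - uv p.1 := rfl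

/-- [folklore] -/
theorem wc_div (μ : Fin (d + 1)) (b : Bool) (k k' : Fin (d + 1)) :
    wc γ (Sum.inl (Sum.inr (μ, b))) k k' = 2 * (if b then (1 : ℝ) else -1) * (if k = γ ∧ k' = μ then 1 else 0) := by
  unfold wc
  cases b
  · simp only [wm, Sum.elim_inl, Sum.elim_inr, Pi.smul_apply, Matrix.smul_apply, dvm, Bool.false_eq_true, if_false,
      Matrix.neg_apply, dirBlock_one_apply, smul_eq_mul]
    ring
  · simp only [wm, Sum.elim_inl, Sum.elim_inr, Pi.smul_apply, Matrix.smul_apply, dvm, if_true, dirBlock_one_apply, smul_eq_mul]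
    ring

/-- [folklore] DIFFERENCE family of the remainder vertex. -/
theorem wα_di (p : Fin (d + 1) × (Fin 4 × Fin 12)) :
    wα uv γ (Sum.inr (Sum.inl (Sum.inl p)) : WilsonIdx (Fin (d + 1))) = boff uv p.1 p.2.1 + diα uv (bd₁ p.1 γ p.2.1) (bd₂ p.1 γ p.2.1) p.2.2 :=
  rfl

/-- [folklore] -/
theorem wβ_di (p : Fin (d + 1) × (Fin 4 × Fin 12)) :
    wβ uv γ (Sum.inr (Sum.inl (Sum.inl p)) : WilsonIdx (Fin (d + 1))) = boff uv p.1 p.2.1 + diβ uv (bd₁ p.1 γ p.2.1) (bd₂ p.1 γ p.2.1) p.2.2 :=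
  rfl

/-- [folklore] -/
theorem wc_di (μ : Fin (d + 1)) (j : Fin 4) (i : Fin 12) (k k' : Fin (d + 1)) :
    wc γ (Sum.inr (Sum.inl (Sum.inl (μ, (j, i))))) k k' = -((2 : ℝ)⁻¹ * (bsgn j * dim (bd₁ μ γ j) (bd₂ μ γ j) (1 : Matrix Unit Unit ℝ) i ((), k) ((), k'))) := by
  unfold wc
  simp [wm, rmm, bsm]

/-- [folklore] TRANSPORT family of the remainder vertex. -/
theorem wα_tr (p : Fin (d + 1) × (Fin 4 × Fin 8)) :
    wα uv γ (Sum.inr (Sum.inl (Sum.inr p)) : WilsonIdx (Fin (d + 1))) = boff uv p.1 p.2.1 + trα uv (bd₁ p.1 γ p.2.1) (bd₂ p.1 γ p.2.1) p.2.2 :=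
  rfl

/-- [folklore] -/
theorem wβ_tr (p : Fin (d + 1) × (Fin 4 × Fin 8)) :
    wβ uv γ (Sum.inr (Sum.inl (Sum.inr p)) : WilsonIdx (Fin (d + 1))) = boff uv p.1 p.2.1 + trβ uv (bd₁ p.1 γ p.2.1) (bd₂ p.1 γ p.2.1) p.2.2 :=
  rfl

/-- [folklore] -/
theorem wc_tr (μ : Fin (d + 1)) (j : Fin 4) (i : Fin 8) (k k' : Fin (d + 1)) :
    wc γ (Sum.inr (Sum.inl (Sum.inr (μ, (j, i))))) k k' = bsgn j * trm (bd₁ μ γ j) (bd₂ μ γ j) (1 : Matrix Unit Unit ℝ) i ((), k) ((), k') := by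
  unfold wc
  simp [wm, rmm, bsm]

/-- [folklore] FAR-CORNER family of the remainder vertex. -/
theorem wα_fa (p : Fin (d + 1) × (Fin 4 × Bool)) :
    wα uv γ (Sum.inr (Sum.inr p) : WilsonIdx (Fin (d + 1))) = boff uv p.1 p.2.1 + faα uv (bd₁ p.1 γ p.2.1) (bd₂ p.1 γ p.2.1) p.2.2 :=
  rfl

/-- [folklore] -/
theorem wβ_fa (p : Fin (d + 1) × (Fin 4 × Bool)) :
    wβ uv γ (Sum.inr (Sum.inr p) : WilsonIdx (Fin (d + 1))) = boff uv p.1 p.2.1 + faβ uv (bd₁ p.1 γ p.2.1) (bd₂ p.1 γ p.2.1) p.2.2 :=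
  rfl

/-- [folklore] -/
theorem wc_fa (μ : Fin (d + 1)) (j : Fin 4) (b : Bool) (k k' : Fin (d + 1)) :
    wc γ (Sum.inr (Sum.inr (μ, (j, b)))) k k' = -(bsgn j * fam (bd₁ μ γ j) (bd₂ μ γ j) (1 : Matrix Unit Unit ℝ) b ((), k) ((), k')) := by
  unfold wc
  simp [wm, rmm, bsm]

end Data

/-! ## §2 The two key graded stencil sums: per family, per transverse direction `μ` -/

section Key

variable {γ β : Fin (d + 1)} (hγβ : γ ≠ β) (φ : ℤ → ℝ)
include hγβ

/-! ### (KL) row-graded, entry `(γ, β)` -/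

/-- [folklore] (KL), current family: every entry `(γ,β)` of `± copies` vanishes. -/
theorem keyL_cur : ∑ b : Bool, φ (wα uv γ (Sum.inl (Sum.inl (Sum.inl b)) : WilsonIdx (Fin (d + 1))) γ) *
    wc γ (Sum.inl (Sum.inl (Sum.inl b))) γ β = 0 := by
  simp [wc_cur, hγβ]

/-- [folklore] (KL), spin family: only `μ = β` contributes, and there the two plaquette copies cancel inside the offset grade `0`. -/
theorem keyL_spin : ∑ p : Fin (d + 1) × Bool, φ (wα uv γ (Sum.inl (Sum.inl (Sum.inr p)) : WilsonIdx (Fin (d + 1))) γ) *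
    wc γ (Sum.inl (Sum.inl (Sum.inr p))) γ β = 0 := by
  rw [Fintype.sum_prod_type]
  refine Finset.sum_eq_zero fun μ _ => ?_
  rw [Fintype.sum_bool]
  simp only [wα_spin, wc_spin]
  by_cases hμ : μ = β
  · subst hμ
    simp [uv, unitVec_apply, hγβ]
  · simp [hμ, hγβ]

omit hγβ in
/-- [folklore] (KL), longitudinal family: row offsets all `0`, the paired blocks cancel for every `μ`. -/
theorem keyL_div : ∑ p : Fin (d + 1) × Bool, φ (wα uv γ (Sum.inl (Sum.inr p) : WilsonIdx (Fin (d + 1))) γ) *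
    wc γ (Sum.inl (Sum.inr p)) γ β = 0 := by
  rw [Fintype.sum_prod_type]
  refine Finset.sum_eq_zero fun μ _ => ?_
  rw [Fintype.sum_bool]
  simp only [wα_div, wc_div, if_true, Bool.false_eq_true, if_false]
  ring

/-- [folklore] (KL), difference family: for `μ ≠ β` every entry vanishes; at `μ = β` the 48 located blocks cancel inside each offset grade. -/
theorem keyL_di : ∑ p : Fin (d + 1) × (Fin 4 × Fin 12), φ (wα uv γ (Sum.inr (Sum.inl (Sum.inl p)) : WilsonIdx (Fin (d + 1))) γ) *
    wc γ (Sum.inr (Sum.inl (Sum.inl p))) γ β = 0 := by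
  rw [Fintype.sum_prod_type]
  refine Finset.sum_eq_zero fun μ _ => ?_
  rw [Fintype.sum_prod_type]
  simp only [Fin.sum_univ_succ, Fin.sum_univ_zero, wα_di, wc_di, bd₁, bd₂, bsgn, boff, diα, dim, Matrix.cons_val_zero,
    Matrix.cons_val_succ, Matrix.smul_apply, Matrix.neg_apply, Pi.add_apply, Pi.neg_apply, Pi.zero_apply, dirBlock_one_apply,
    uv, unitVec_apply, smul_eq_mul]
  by_cases hμ : μ = β
  · subst hμ
    simp [hγβ, hγβ.symm]
  · simp [Ne.symm hμ, hγβ.symm]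

/-- [folklore] (KL), transport family. -/
theorem keyL_tr : ∑ p : Fin (d + 1) × (Fin 4 × Fin 8), φ (wα uv γ (Sum.inr (Sum.inl (Sum.inr p)) : WilsonIdx (Fin (d + 1))) γ) *
    wc γ (Sum.inr (Sum.inl (Sum.inr p))) γ β = 0 := by
  rw [Fintype.sum_prod_type]
  refine Finset.sum_eq_zero fun μ _ => ?_
  rw [Fintype.sum_prod_type]
  simp only [Fin.sum_univ_succ, Fin.sum_univ_zero, wα_tr, wc_tr, bd₁, bd₂, bsgn, boff, trα, trm, Matrix.cons_val_zero,
    Matrix.cons_val_succ, Matrix.neg_apply, Pi.add_apply, Pi.neg_apply, Pi.zero_apply, dirBlock_one_apply, uv, unitVec_apply]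
  by_cases hμ : μ = β
  · subst hμ
    simp [hγβ, hγβ.symm]
  · simp [Ne.symm hμ, hγβ.symm]

/-- [folklore] (KL), far-corner family. -/
theorem keyL_fa : ∑ p : Fin (d + 1) × (Fin 4 × Bool), φ (wα uv γ (Sum.inr (Sum.inr p) : WilsonIdx (Fin (d + 1))) γ) *
    wc γ (Sum.inr (Sum.inr p)) γ β = 0 := by
  rw [Fintype.sum_prod_type]
  refine Finset.sum_eq_zero fun μ _ => ?_
  rw [Fintype.sum_prod_type]
  simp only [Fin.sum_univ_succ, Fin.sum_univ_zero, Fintype.sum_bool, wα_fa, wc_fa, bd₁, bd₂, bsgn, boff, faα, fam,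
    Matrix.cons_val_zero, Matrix.cons_val_succ, Matrix.neg_apply, Pi.add_apply, Pi.neg_apply, Pi.zero_apply, dirBlock_one_apply, uv,
    unitVec_apply, if_true, Bool.false_eq_true, if_false]
  by_cases hμ : μ = β
  · subst hμ
    simp [hγβ, hγβ.symm]
  · simp [Ne.symm hμ, hγβ.symm]

/-- [folklore] **(KL) — THE ROW-GRADED STENCIL SUM OF THE `(γ, β)` ENTRIES VANISHES** (`γ ≠ β`, any weight `φ` of the row offset's
`γ`-coordinate): `Σ_i φ ((wα i) γ) · wc γ i γ β = 0`. -/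
theorem keyL : ∑ i : WilsonIdx (Fin (d + 1)), φ (wα uv γ i γ) * wc γ i γ β = 0 := by
  rw [Fintype.sum_sum_type, Fintype.sum_sum_type, Fintype.sum_sum_type, Fintype.sum_sum_type, Fintype.sum_sum_type,
    keyL_cur hγβ φ, keyL_spin hγβ φ, keyL_div φ, keyL_di hγβ φ, keyL_tr hγβ φ, keyL_fa hγβ φ]
  simp

/-! ### (KR) column-graded, entry `(β, γ)` -/

/-- [folklore] (KR), current family. -/
theorem keyR_cur : ∑ b : Bool, φ (wβ uv γ (Sum.inl (Sum.inl (Sum.inl b)) : WilsonIdx (Fin (d + 1))) γ) *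
    wc γ (Sum.inl (Sum.inl (Sum.inl b))) β γ = 0 := by
  simp [wc_cur, hγβ.symm]

/-- [folklore] (KR), spin family. -/
theorem keyR_spin : ∑ p : Fin (d + 1) × Bool, φ (wβ uv γ (Sum.inl (Sum.inl (Sum.inr p)) : WilsonIdx (Fin (d + 1))) γ) *
    wc γ (Sum.inl (Sum.inl (Sum.inr p))) β γ = 0 := by
  rw [Fintype.sum_prod_type]
  refine Finset.sum_eq_zero fun μ _ => ?_
  rw [Fintype.sum_bool]
  simp only [wβ_spin, wc_spin]
  by_cases hμ : μ = β
  · subst hμ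
    simp [uv, unitVec_apply, hγβ]
  · simp [hμ, hγβ]

/-- [folklore] (KR), longitudinal family: every `(β, γ)` entry of `± dirBlock γ μ` vanishes. -/
theorem keyR_div : ∑ p : Fin (d + 1) × Bool, φ (wβ uv γ (Sum.inl (Sum.inr p) : WilsonIdx (Fin (d + 1))) γ) *
    wc γ (Sum.inl (Sum.inr p)) β γ = 0 := by
  rw [Fintype.sum_prod_type]
  refine Finset.sum_eq_zero fun μ _ => ?_
  rw [Fintype.sum_bool]
  simp only [wβ_div, wc_div]
  simp [hγβ.symm]

/-- [folklore] (KR), difference family. -/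
theorem keyR_di : ∑ p : Fin (d + 1) × (Fin 4 × Fin 12), φ (wβ uv γ (Sum.inr (Sum.inl (Sum.inl p)) : WilsonIdx (Fin (d + 1))) γ) *
    wc γ (Sum.inr (Sum.inl (Sum.inl p))) β γ = 0 := by
  rw [Fintype.sum_prod_type]
  refine Finset.sum_eq_zero fun μ _ => ?_
  rw [Fintype.sum_prod_type]
  simp only [Fin.sum_univ_succ, Fin.sum_univ_zero, wβ_di, wc_di, bd₁, bd₂, bsgn, boff, diβ, dim, Matrix.cons_val_zero,
    Matrix.cons_val_succ, Matrix.smul_apply, Matrix.neg_apply, Pi.add_apply, Pi.neg_apply, Pi.zero_apply, dirBlock_one_apply,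
    uv, unitVec_apply, smul_eq_mul]
  by_cases hμ : μ = β
  · subst hμ
    simp [hγβ, hγβ.symm]
  · simp [Ne.symm hμ, hγβ.symm]

/-- [folklore] (KR), transport family. -/
theorem keyR_tr : ∑ p : Fin (d + 1) × (Fin 4 × Fin 8), φ (wβ uv γ (Sum.inr (Sum.inl (Sum.inr p)) : WilsonIdx (Fin (d + 1))) γ) *
    wc γ (Sum.inr (Sum.inl (Sum.inr p))) β γ = 0 := by
  rw [Fintype.sum_prod_type]
  refine Finset.sum_eq_zero fun μ _ => ?_
  rw [Fintype.sum_prod_type]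
  simp only [Fin.sum_univ_succ, Fin.sum_univ_zero, wβ_tr, wc_tr, bd₁, bd₂, bsgn, boff, trβ, trm, Matrix.cons_val_zero,
    Matrix.cons_val_succ, Matrix.neg_apply, Pi.add_apply, Pi.neg_apply, Pi.zero_apply, dirBlock_one_apply, uv, unitVec_apply]
  by_cases hμ : μ = β
  · subst hμ
    simp [hγβ, hγβ.symm]
  · simp [Ne.symm hμ, hγβ.symm]

/-- [folklore] (KR), far-corner family. -/
theorem keyR_fa : ∑ p : Fin (d + 1) × (Fin 4 × Bool), φ (wβ uv γ (Sum.inr (Sum.inr p) : WilsonIdx (Fin (d + 1))) γ) *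
    wc γ (Sum.inr (Sum.inr p)) β γ = 0 := by
  rw [Fintype.sum_prod_type]
  refine Finset.sum_eq_zero fun μ _ => ?_
  rw [Fintype.sum_prod_type]
  simp only [Fin.sum_univ_succ, Fin.sum_univ_zero, Fintype.sum_bool, wβ_fa, wc_fa, bd₁, bd₂, bsgn, boff, faβ, fam,
    Matrix.cons_val_zero, Matrix.cons_val_succ, Matrix.neg_apply, Pi.add_apply, Pi.neg_apply, Pi.zero_apply, dirBlock_one_apply, uv,
    unitVec_apply, if_true, Bool.false_eq_true, if_false]
  by_cases hμ : μ = β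
  · subst hμ
    simp [hγβ, hγβ.symm]
  · simp [Ne.symm hμ, hγβ.symm]

/-- [folklore] **(KR) — THE COLUMN-GRADED STENCIL SUM OF THE `(β, γ)` ENTRIES VANISHES** (`γ ≠ β`, any weight `φ` of the column offset's
`γ`-coordinate): `Σ_i φ ((wβ i) γ) · wc γ i β γ = 0`. -/
theorem keyR : ∑ i : WilsonIdx (Fin (d + 1)), φ (wβ uv γ i γ) * wc γ i β γ = 0 := by
  rw [Fintype.sum_sum_type, Fintype.sum_sum_type, Fintype.sum_sum_type, Fintype.sum_sum_type, Fintype.sum_sum_type,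
    keyR_cur hγβ φ, keyR_spin hγβ φ, keyR_div hγβ φ, keyR_di hγβ φ, keyR_tr hγβ φ, keyR_fa hγβ φ]
  simp

end Key

end Summit.QuantumFields.BalabanUV.Beta.GAN24.WilsonGradedBlockSums

end
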